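import Literature.InformationTheory.Entanglement.GHZFidelityWitness
import Mathlib.Algebra.Order.Chebyshev
import HarnessLib

/-!
# The `W`-state fidelity witness: `F(ρ, |W_N⟩) > (N−1)/N ⟹` genuine `N`-partite entanglement

Topic `Literature/InformationTheory/Entanglement`, companion of `GHZFidelityWitness.lean` (same
register `Fin N → Bool`, same notions `tensorAcross`, `IsBiseparablePure`, `IsBiseparable`,
`vecState`).  Source (held text, read at the cited places):

* O. Gühne, G. Tóth, *Entanglement detection*, Phys. Rep. 474, 1 (2009) = arXiv:0811.2803
  [GuhneToth2009]: §3.3 eq. (42) “`|W₃⟩ = (|100⟩ + |010⟩ + |001⟩)/√3`”; §3.6.1 eqs. (70)–(71)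
  (projector witnesses `𝒲 = α𝟙 − |ψ⟩⟨ψ|`, `α` = the maximal squared overlap with biseparable
  states) and “a witness for genuine multipartite entanglement around the state `|W₃⟩` would be
  `𝒲_{W₃} = 2/3·𝟙 − |W₃⟩⟨W₃|`”; §3.6.2 eq. (74) “For some symmetric Dicke states, the maximal
  overlap can also be computed straightforwardly [213], e.g., a witness for the `|W_N⟩` state reads
  **`𝒲_{W_N} = ((N−1)/N)𝟙 − |W_N⟩⟨W_N|`**”; §6.8 eq. (160)
  “`|W_N⟩ = (|00…01⟩ + |00…10⟩ + … + |10…00⟩)/√N`” (the trapped-ion experiment with “strings of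
  up to eight ⁴⁰Ca⁺ ions”, Table 2: fidelities `F = 0.846, 0.759, 0.788, 0.763, 0.722` for
  `N = 4,…,8`); §6.8.2 “A first tool for the analysis of the states is the fidelity-based witness
  `𝒲 = ((N−1)/N)𝟙 − |W_N⟩⟨W_N|`. However, as can be seen from the fidelities in Table 2, this
  witness does not detect any entanglement for `N ≥ 5`. … if one calculates the overlap with a
  biseparable state `|φ⟩ = |a⟩|b⟩` it suffices to assume that `|a⟩` and `|b⟩` have maximally one
  excitation … `𝒲 = ((N−1)/N) P_{≤2} − |W_N⟩⟨W_N|` (162), where `P_{≤2}` is the projector onto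
  the space with maximally two excitations, is a valid witness”.

HONEST FRAMING (pub-qadeq lane — ‘largest genuinely multipartite entangled W state’ milestones,
ion-trap / photonic / superconducting): instance-level adjudication of specific advantage claims;
no claim about BQP vs BPP or the summit.  This file proves the criterion; whether a reported
fidelity estimates the prepared state's fidelity (tomography, maximum likelihood, error bars) is
not addressed here.

## Contents (all proved, 0 named facts)

* `exc i` (the one-excitation label `0…010…0`), `wVec ι` (the `W` vector on any finite register
  `ι → Bool`), `wN N = |W_N⟩` (eq. (160)); `wVec_dotProduct` (`⟨W|ψ⟩ = (1/√N) Σ_i ψ(e_i)`),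
  `wN_norm` (`⟨W_N|W_N⟩ = 1`).
* **`star_wN_dotProduct_tensorAcross`** — the one-excitation reduction of §6.8.2: across a cut
  `A | Ā`, `⟨W_N| a ⊗ b⟩ = (1/√N)·(b(0…0)·Σ_{i∈A} a(e_i) + a(0…0)·Σ_{j∈Ā} b(e_j))`.
* **`normSq_wN_overlap_le`** — for a cut with `|A| = k`, `|Ā| = N − k`, both non-empty:
  `N·|⟨W_N| a ⊗ b⟩|² ≤ max(k, N−k)·‖a‖²‖b‖²`; hence **`normSq_wN_overlap_le_of_isBiseparablePure`**:
  `|⟨W_N|ψ⟩|² ≤ ((N−1)/N)·⟨ψ|ψ⟩` for every biseparable pure `ψ` (the “maximal overlap” behind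
  eq. (74)), and it is attained: **`normSq_wN_overlap_zero_tensor`** (`|0⟩ ⊗ |W_{N−1}⟩` has
  squared overlap exactly `(N−1)/N`).
* Mixed states: `wFidelity ρ = ⟨W_N|ρ|W_N⟩`; **`wFidelity_le`** (`≤ (N−1)/N` on biseparable `ρ`,
  i.e. `Tr(ρ 𝒲_{W_N}) ≥ 0`, eq. (74)); **`not_isBiseparable_of_lt_wFidelity`** (the GME
  criterion `F > (N−1)/N`); `wFidelity_wN` (`= 1`) and `not_isBiseparable_wN`.
* The improved witness (162): `excCount` (number of excitations), `projLE2 N = P_{≤2}`,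
  **`lowMass_le_vecState_projLE2`** (the vacuum/one-excitation mass of the two sides of `a ⊗ b`
  sits on labels with `≤ 2` excitations), **`normSq_wN_overlap_le_projLE2_of_isBiseparablePure`**
  (`|⟨W_N|ψ⟩|² ≤ ((N−1)/N)·⟨ψ|P_{≤2}|ψ⟩`), `wWitness₂ N = ((N−1)/N)·P_{≤2} − |W_N⟩⟨W_N|`,
  **`guhneToth_wWitness₂`** (`Tr(ρ𝒲) ≥ 0` on biseparable `ρ` — “is a valid witness”),
  `trState_wWitness₂_wN` (`= −1/N`), `vecState_projLE2_le` (`P_{≤2} ≤ 𝟙`, so (162) refines (74)).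
* Reading Table 2 against the criterion (§6.8.2's sentence): `table2_detects_four`
  (`3/4 < 0.846`) and `table2_not_detected_five_to_eight` (`0.759 ≤ 4/5`, …, `0.722 ≤ 7/8`).
* Appended (gen 43): white-noise tolerance of the fidelity witness [GuhneToth2009, Table 1]:
  `wWhiteNoise` (`(1 − p)|W_N⟩⟨W_N| + p𝟙/2^N`), `wFidelity_wWhiteNoise`,
  `lt_wFidelity_wWhiteNoise_iff` (detected iff `p < 1/N·[1/(1 − 1/2^N)]`),
  `not_isBiseparable_wWhiteNoise`, `wWhiteNoise_threshold_three` (`= 8/21`).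

NOT formalised: the three-parameter ansatz (163) (numerical optimisation over `α, β, γ`), local
filters (164), the Dicke-state witness (75), statistics of the fidelity estimate.

## Mathlib / tree search

No `W` state in Mathlib or the tree (`lean search 'W state|wState|Dicke'` empty).  Reused from
`GHZFidelityWitness.lean`: `tensorAcross`, `restrictIn/Out`, `tensorAcross_normSq`,
`IsBiseparablePure`, `IsBiseparable`, `vecState_vecMulVec`, `vecState_sum_smul_vecMulVec`,
`trace_sum_smul_vecMulVec`, `trace_eq_one_of_isBiseparable`; Mathlib's
`sq_sum_le_card_mul_sum_sq` (Cauchy–Schwarz on a finset).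
-/

namespace Literature.InformationTheory.Entanglement

namespace WWitness

open Matrix Complex Finset
open Literature.InformationTheory.Entanglement.Tsirelson
open GHZWitness

variable {N : ℕ}

/-! ## One-excitation labels and the `W` vector on a finite register -/

section Labels

variable {ι : Type*} [DecidableEq ι]

/-- The one-excitation basis label `e_i = 0…010…0` (qubit `i` in `|1⟩`, the rest in `|0⟩`), the
terms of eq. (160). [cite: GuhneToth2009, §6.8 eq. (160)] -/
def exc (i : ι) : ι → Bool := fun j => decide (j = i)

/-- Unfolding `exc`. [cite: GuhneToth2009, §6.8 eq. (160)] -/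
@[simp] theorem exc_apply (i j : ι) : exc i j = decide (j = i) := rfl

/-- Distinct qubits give distinct one-excitation labels. [cite: GuhneToth2009, §6.8 eq. (160)] -/
theorem exc_injective : Function.Injective (exc : ι → ι → Bool) := by
  intro i j h
  have hi := congrFun h i
  simp only [exc_apply, decide_true, Bool.true_eq, decide_eq_true_eq] at hi
  exact hi

/-- A one-excitation label is not the vacuum label `0…0`. [cite: GuhneToth2009, §6.8 eq. (160)] -/
theorem exc_ne_zero (i : ι) : exc i ≠ fun _ => false := by
  intro h
  have hi := congrFun h i
  simp at hi

/-- The vacuum label is not a one-excitation label. [cite: GuhneToth2009, §6.8 eq. (160)] -/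
theorem zero_ne_exc (i : ι) : (fun _ => false) ≠ exc i := (exc_ne_zero i).symm

end Labels

section Generic

variable {ι : Type*} [Fintype ι]

/-- The amplitude `1/√n` of eq. (160) on an `n`-qubit register. [cite: GuhneToth2009, §6.8
eq. (160)] -/
noncomputable def wAmp (ι : Type*) [Fintype ι] : ℝ := (Real.sqrt (Fintype.card ι))⁻¹

/-- `(1/√n)² · n = 1` (`n ≥ 1`). [cite: GuhneToth2009, §6.8 eq. (160)] -/
theorem wAmp_mul_wAmp_mul_card [Nonempty ι] :
    wAmp ι * wAmp ι * Fintype.card ι = 1 := by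
  have hn : (0 : ℝ) < Fintype.card ι := by exact_mod_cast Fintype.card_pos
  rw [wAmp, ← mul_inv, Real.mul_self_sqrt hn.le, inv_mul_cancel₀ hn.ne']

variable [DecidableEq ι]

/-- The `W` vector of an `n`-qubit register `ι → Bool`:
`|W⟩ = (1/√n) Σ_i |e_i⟩`, i.e. amplitude `1/√n` on each one-excitation label and `0` elsewhere.
[cite: GuhneToth2009, §6.8 eq. (160)] -/
noncomputable def wVec (ι : Type*) [Fintype ι] [DecidableEq ι] : (ι → Bool) → ℂ :=
  fun x => (wAmp ι : ℂ) * ∑ i : ι, if x = exc i then (1 : ℂ) else 0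

/-- Unfolding `wVec`. [cite: GuhneToth2009, §6.8 eq. (160)] -/
theorem wVec_apply (x : ι → Bool) :
    wVec ι x = (wAmp ι : ℂ) * ∑ i : ι, if x = exc i then (1 : ℂ) else 0 := rfl

/-- The amplitude on `|e_i⟩` is `1/√n`. [cite: GuhneToth2009, §6.8 eq. (160)] -/
theorem wVec_exc (i : ι) : wVec ι (exc i) = wAmp ι := by
  rw [wVec_apply]
  have : ∑ j : ι, (if exc i = exc j then (1 : ℂ) else 0) = 1 := by
    simp [exc_injective.eq_iff]
  rw [this, mul_one]

/-- The amplitude on the vacuum `|0…0⟩` is `0`. [cite: GuhneToth2009, §6.8 eq. (160)] -/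
theorem wVec_zero : wVec ι (fun _ => false) = 0 := by
  rw [wVec_apply]
  simp [zero_ne_exc]

/-- The `W` vector has real amplitudes. [cite: GuhneToth2009, §6.8 eq. (160)] -/
@[simp] theorem star_wVec : star (wVec ι) = wVec ι := by
  ext x
  rw [Pi.star_apply, wVec_apply, star_mul', Complex.star_def, Complex.conj_ofReal, map_sum]
  congr 1
  refine Finset.sum_congr rfl fun i _ => ?_
  split_ifs <;> simp

/-- `⟨W|ψ⟩ = (1/√n) Σ_i ψ(e_i)`: only one-excitation amplitudes are seen by `|W⟩` (“The
projector onto the W state is a matrix that is acting on the subspace with one excitation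
only”). [cite: GuhneToth2009, §6.8.2] -/
theorem wVec_dotProduct (ψ : (ι → Bool) → ℂ) :
    wVec ι ⬝ᵥ ψ = (wAmp ι : ℂ) * ∑ i, ψ (exc i) := by
  have hx : ∀ x, wVec ι x * ψ x = (wAmp ι : ℂ) * ∑ i, (if x = exc i then ψ x else 0) := by
    intro x
    rw [wVec_apply, mul_assoc, Finset.sum_mul]
    congr 1
    refine Finset.sum_congr rfl fun i _ => ?_
    split_ifs <;> simp
  calc wVec ι ⬝ᵥ ψ = ∑ x, (wAmp ι : ℂ) * ∑ i, (if x = exc i then ψ x else 0) := by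
        simp only [dotProduct, hx]
    _ = (wAmp ι : ℂ) * ∑ i, ∑ x, (if x = exc i then ψ x else 0) := by
        rw [← Finset.mul_sum, Finset.sum_comm]
    _ = (wAmp ι : ℂ) * ∑ i, ψ (exc i) := by
        congr 1
        refine Finset.sum_congr rfl fun i _ => ?_
        simp

/-- `⟨W|W⟩ = 1` (`n ≥ 1`). [cite: GuhneToth2009, §6.8 eq. (160)] -/
theorem wVec_norm [Nonempty ι] : star (wVec ι) ⬝ᵥ wVec ι = 1 := by
  rw [star_wVec, wVec_dotProduct]
  simp only [wVec_exc, Finset.sum_const, Finset.card_univ, nsmul_eq_mul]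
  rw [mul_comm ((Fintype.card ι : ℕ) : ℂ), ← mul_assoc]
  exact_mod_cast wAmp_mul_wAmp_mul_card (ι := ι)

/-- `|ψ(0…0)|² + Σ_i |ψ(e_i)|² ≤ ‖ψ‖²`: the vacuum and the one-excitation labels are distinct
basis labels (“it suffices to assume that `|a⟩` and `|b⟩` have maximally one excitation”).
[cite: GuhneToth2009, §6.8.2] -/
theorem normSq_zero_add_sum_exc_le (ψ : (ι → Bool) → ℂ) :
    Complex.normSq (ψ fun _ => false) + ∑ i, Complex.normSq (ψ (exc i)) ≤
      ∑ x, Complex.normSq (ψ x) := by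
  classical
  have himg : ∑ i, Complex.normSq (ψ (exc i)) =
      ∑ x ∈ Finset.univ.image (exc : ι → ι → Bool), Complex.normSq (ψ x) := by
    rw [Finset.sum_image fun i _ j _ h => exc_injective h]
  have h0 : (fun _ => false : ι → Bool) ∉ Finset.univ.image (exc : ι → ι → Bool) := by
    simp [Finset.mem_image, exc_ne_zero]
  rw [himg, ← Finset.sum_insert (f := fun x => Complex.normSq (ψ x)) h0]
  exact Finset.sum_le_sum_of_subset_of_nonneg (Finset.subset_univ _)
    fun _ _ _ => Complex.normSq_nonneg _

/-- Cauchy–Schwarz on the one-excitation amplitudes: `|Σ_i ψ(e_i)|² ≤ n · Σ_i |ψ(e_i)|²`.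
[cite: GuhneToth2009, §6.8.2] -/
theorem normSq_sum_exc_le (ψ : (ι → Bool) → ℂ) :
    Complex.normSq (∑ i, ψ (exc i)) ≤ Fintype.card ι * ∑ i, Complex.normSq (ψ (exc i)) := by
  rw [Complex.normSq_eq_norm_sq]
  calc ‖∑ i, ψ (exc i)‖ ^ 2 ≤ (∑ i, ‖ψ (exc i)‖) ^ 2 := by
        gcongr; exact norm_sum_le _ _
    _ ≤ (Finset.univ : Finset ι).card * ∑ i, ‖ψ (exc i)‖ ^ 2 := sq_sum_le_card_mul_sum_sq
    _ = Fintype.card ι * ∑ i, Complex.normSq (ψ (exc i)) := by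
        simp only [Finset.card_univ, Complex.normSq_eq_norm_sq]

end Generic

/-! ## `|W_N⟩` on the register `Fin N → Bool` -/

/-- The `N`-qubit `W` state `|W_N⟩ = (|00…01⟩ + |00…10⟩ + … + |10…00⟩)/√N` (eq. (160); eq. (42)
for `N = 3`). [cite: GuhneToth2009, §6.8 eq. (160) and §3.3 eq. (42)] -/
noncomputable def wN (N : ℕ) : (Fin N → Bool) → ℂ := wVec (Fin N)

/-- Unfolding `wN`. [cite: GuhneToth2009, §6.8 eq. (160)] -/
theorem wN_eq : wN N = wVec (Fin N) := rfl

/-- `|W_N⟩` has real amplitudes. [cite: GuhneToth2009, §6.8 eq. (160)] -/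
@[simp] theorem star_wN : star (wN N) = wN N := star_wVec

/-- `⟨W_N|W_N⟩ = 1` for `N ≥ 1`. [cite: GuhneToth2009, §6.8 eq. (160)] -/
theorem wN_norm [NeZero N] : star (wN N) ⬝ᵥ wN N = 1 := by
  haveI : Nonempty (Fin N) := ⟨⟨0, Nat.pos_of_ne_zero (NeZero.ne N)⟩⟩
  exact wVec_norm

/-- `1/√N · 1/√N · N = 1`. [cite: GuhneToth2009, §6.8 eq. (160)] -/
theorem wAmp_fin_sq_mul [NeZero N] : wAmp (Fin N) * wAmp (Fin N) * N = 1 := by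
  haveI : Nonempty (Fin N) := ⟨⟨0, Nat.pos_of_ne_zero (NeZero.ne N)⟩⟩
  have h := wAmp_mul_wAmp_mul_card (ι := Fin N)
  rwa [Fintype.card_fin] at h

/-! ## The one-excitation reduction across a cut `A | Ā` -/

section Cut

variable (A : Finset (Fin N))

/-- For `i ∈ A`: `e_i|_A = e_i` (one excitation on the `A` side). [cite: GuhneToth2009, §6.8.2] -/
theorem restrictIn_exc_mem (u : {i // i ∈ A}) :
    restrictIn A (exc (u : Fin N)) = exc u := by
  funext w
  simp only [restrictIn, exc_apply]
  by_cases h : w = u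
  · subst h; simp
  · have h' : (w : Fin N) ≠ u := fun e => h (Subtype.ext e)
    simp [h, h']

/-- For `i ∈ A`: `e_i|_Ā = 0…0` (no excitation on the `Ā` side). [cite: GuhneToth2009, §6.8.2] -/
theorem restrictOut_exc_mem (u : {i // i ∈ A}) :
    restrictOut A (exc (u : Fin N)) = fun _ => false := by
  funext w
  simp only [restrictOut, exc_apply]
  have h' : (w : Fin N) ≠ u := fun e => w.2 (e ▸ u.2)
  simp [h']

/-- For `j ∉ A`: `e_j|_A = 0…0`. [cite: GuhneToth2009, §6.8.2] -/
theorem restrictIn_exc_not_mem (v : {i // i ∉ A}) :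
    restrictIn A (exc (v : Fin N)) = fun _ => false := by
  funext w
  simp only [restrictIn, exc_apply]
  have h' : (w : Fin N) ≠ v := fun e => v.2 (e ▸ w.2)
  simp [h']

/-- For `j ∉ A`: `e_j|_Ā = e_j`. [cite: GuhneToth2009, §6.8.2] -/
theorem restrictOut_exc_not_mem (v : {i // i ∉ A}) :
    restrictOut A (exc (v : Fin N)) = exc v := by
  funext w
  simp only [restrictOut, exc_apply]
  by_cases h : w = v
  · subst h; simp
  · have h' : (w : Fin N) ≠ v := fun e => h (Subtype.ext e)
    simp [h, h']

/-- **The one-excitation reduction** (§6.8.2): across a cut `A | Ā`,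
`⟨W_N| a ⊗ b⟩ = (1/√N)·(b(0…0)·Σ_{i∈A} a(e_i) + a(0…0)·Σ_{j∈Ā} b(e_j))` — a one-excitation label
of the whole register has its excitation either in `A` (and then `Ā` is in the vacuum) or in `Ā`.
[cite: GuhneToth2009, §6.8.2] -/
theorem star_wN_dotProduct_tensorAcross (a : ({i // i ∈ A} → Bool) → ℂ)
    (b : ({i // i ∉ A} → Bool) → ℂ) :
    star (wN N) ⬝ᵥ tensorAcross A a b =
      (wAmp (Fin N) : ℂ) * (b (fun _ => false) * ∑ u : {i // i ∈ A}, a (exc u) +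
        a (fun _ => false) * ∑ v : {i // i ∉ A}, b (exc v)) := by
  rw [star_wN, wN_eq, wVec_dotProduct]
  congr 1
  have split : ∑ i : Fin N, tensorAcross A a b (exc i) =
      ∑ s : {i // i ∈ A} ⊕ {i // i ∉ A}, tensorAcross A a b (exc (Equiv.sumCompl (· ∈ A) s)) :=
    (Fintype.sum_equiv (Equiv.sumCompl (· ∈ A)) _ _ fun _ => rfl).symm
  rw [split, Fintype.sum_sum_type]
  simp only [Equiv.sumCompl_apply_inl, Equiv.sumCompl_apply_inr, tensorAcross_apply,
    restrictIn_exc_mem, restrictOut_exc_mem, restrictIn_exc_not_mem, restrictOut_exc_not_mem]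
  rw [← Finset.sum_mul, ← Finset.mul_sum]
  ring

variable {A}

/-- `|A|` as the cardinality of the subtype. [cite: GuhneToth2009, §6.8.2] -/
private theorem card_in : Fintype.card {i // i ∈ A} = A.card := Fintype.card_coe A

/-- `|Ā| = N − |A|` as the cardinality of the subtype. [cite: GuhneToth2009, §6.8.2] -/
private theorem card_out : Fintype.card {i // i ∉ A} = Aᶜ.card := by
  rw [Fintype.card_subtype_compl, Finset.card_compl, Fintype.card_coe]

/-- The polynomial step: `m(uf + vg)² ≤ (m u² + g²)(f² + m v²)` (`= ` C–S with weights).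
[cite: GuhneToth2009, §3.6.1 eq. (71)] -/
private theorem weighted_cs (m u f v g : ℝ) :
    m * (u * f + v * g) ^ 2 ≤ (m * u ^ 2 + g ^ 2) * (f ^ 2 + m * v ^ 2) := by
  nlinarith [sq_nonneg (m * u * v - f * g)]

/-- `Re⟨ψ|ψ⟩ = Σ_x |ψ(x)|²`. [cite: GuhneToth2009, §3.6.1 eq. (70)] -/
private theorem star_dotProduct_self_re {κ : Type*} [Fintype κ] (ψ : κ → ℂ) :
    (star ψ ⬝ᵥ ψ).re = ∑ x, Complex.normSq (ψ x) := by
  rw [dotProduct, Complex.re_sum]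
  refine Finset.sum_congr rfl fun x _ => ?_
  rw [Pi.star_apply, Complex.star_def, ← Complex.normSq_eq_conj_mul_self, Complex.ofReal_re]

/-- **The core estimate** behind both (74) and (162): across a cut `A | Ā` with `|A| = k ≥ 1`,
`|Ā| = m ≥ 1`,
`N·|⟨W_N| a ⊗ b⟩|² ≤ max(k, m)·(|a(0)|² + Σ_{i∈A}|a(e_i)|²)·(|b(0)|² + Σ_{j∈Ā}|b(e_j)|²)` — only the
vacuum and one-excitation amplitudes of each side enter (“it suffices to assume that `|a⟩` and
`|b⟩` have maximally one excitation”).  Proof: the one-excitation reduction,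
`|b₀Φ + a₀Χ| ≤ |b₀||Φ| + |a₀||Χ|`, Cauchy–Schwarz `|Φ|² ≤ k Σ|a(e_i)|²`, `|Χ|² ≤ m Σ|b(e_j)|²`
and the weighted Cauchy–Schwarz step `m(uf + vg)² ≤ (m u² + g²)(f² + m v²)`.
[cite: GuhneToth2009, §6.8.2 with §3.6.1 eqs. (70)–(71)] -/
theorem normSq_wN_overlap_le_lowMass (hA : A.Nonempty) (hAc : Aᶜ.Nonempty)
    (a : ({i // i ∈ A} → Bool) → ℂ) (b : ({i // i ∉ A} → Bool) → ℂ) :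
    (N : ℝ) * Complex.normSq (star (wN N) ⬝ᵥ tensorAcross A a b) ≤
      (max A.card Aᶜ.card : ℕ) *
        ((Complex.normSq (a fun _ => false) + ∑ u, Complex.normSq (a (exc u))) *
          (Complex.normSq (b fun _ => false) + ∑ v, Complex.normSq (b (exc v)))) := by
  have hN : N ≠ 0 := by
    obtain ⟨i, -⟩ := hA
    exact Nat.pos_iff_ne_zero.1 (Fin.pos i)
  haveI : NeZero N := ⟨hN⟩
  rw [star_wN_dotProduct_tensorAcross, Complex.normSq_mul, Complex.normSq_ofReal, ← mul_assoc,
    mul_comm (N : ℝ), wAmp_fin_sq_mul, one_mul, Complex.normSq_eq_norm_sq (a fun _ => false),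
    Complex.normSq_eq_norm_sq (b fun _ => false)]
  -- names
  set a₀ := a fun _ => false
  set b₀ := b fun _ => false
  set Φ := ∑ u : {i // i ∈ A}, a (exc u)
  set Χ := ∑ v : {i // i ∉ A}, b (exc v)
  set Aw := ∑ u : {i // i ∈ A}, Complex.normSq (a (exc u))
  set Bw := ∑ v : {i // i ∉ A}, Complex.normSq (b (exc v))
  have hm : (1 : ℝ) ≤ Aᶜ.card := by exact_mod_cast hAc.card_pos
  set M : ℝ := ((max A.card Aᶜ.card : ℕ) : ℝ) with hM
  have hkM : (A.card : ℝ) ≤ M := by rw [hM]; exact_mod_cast le_max_left _ _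
  have hmM : (Aᶜ.card : ℝ) ≤ M := by rw [hM]; exact_mod_cast le_max_right _ _
  -- the inputs
  have hΦ : ‖Φ‖ ^ 2 ≤ A.card * Aw := by
    rw [← Complex.normSq_eq_norm_sq, ← card_in]; exact normSq_sum_exc_le _
  have hΧ : ‖Χ‖ ^ 2 ≤ Aᶜ.card * Bw := by
    rw [← Complex.normSq_eq_norm_sq, ← card_out]; exact normSq_sum_exc_le _
  have hAw : 0 ≤ Aw := Finset.sum_nonneg fun _ _ => Complex.normSq_nonneg _
  have hBw : 0 ≤ Bw := Finset.sum_nonneg fun _ _ => Complex.normSq_nonneg _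
  -- triangle inequality
  have h1 : Complex.normSq (b₀ * Φ + a₀ * Χ) ≤ (‖b₀‖ * ‖Φ‖ + ‖a₀‖ * ‖Χ‖) ^ 2 := by
    rw [Complex.normSq_eq_norm_sq]
    gcongr
    calc ‖b₀ * Φ + a₀ * Χ‖ ≤ ‖b₀ * Φ‖ + ‖a₀ * Χ‖ := norm_add_le _ _
      _ = ‖b₀‖ * ‖Φ‖ + ‖a₀‖ * ‖Χ‖ := by rw [norm_mul, norm_mul]
  -- weighted Cauchy–Schwarz with weight `m = |Ā|`
  have h2 : (Aᶜ.card : ℝ) * (‖b₀‖ * ‖Φ‖ + ‖a₀‖ * ‖Χ‖) ^ 2 ≤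
      ((Aᶜ.card : ℝ) * ‖b₀‖ ^ 2 + ‖Χ‖ ^ 2) * (‖Φ‖ ^ 2 + (Aᶜ.card : ℝ) * ‖a₀‖ ^ 2) :=
    weighted_cs _ _ _ _ _
  have h3 : (Aᶜ.card : ℝ) * ‖b₀‖ ^ 2 + ‖Χ‖ ^ 2 ≤ (Aᶜ.card : ℝ) * (‖b₀‖ ^ 2 + Bw) := by
    linarith [hΧ]
  have h4 : ‖Φ‖ ^ 2 + (Aᶜ.card : ℝ) * ‖a₀‖ ^ 2 ≤ M * (‖a₀‖ ^ 2 + Aw) := by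
    have e1 : (A.card : ℝ) * Aw ≤ M * Aw := mul_le_mul_of_nonneg_right hkM hAw
    have e2 : (Aᶜ.card : ℝ) * ‖a₀‖ ^ 2 ≤ M * ‖a₀‖ ^ 2 :=
      mul_le_mul_of_nonneg_right hmM (sq_nonneg _)
    linarith [hΦ, e1, e2]
  have h5 : (Aᶜ.card : ℝ) * (‖b₀‖ * ‖Φ‖ + ‖a₀‖ * ‖Χ‖) ^ 2 ≤
      (Aᶜ.card : ℝ) * (M * ((‖a₀‖ ^ 2 + Aw) * (‖b₀‖ ^ 2 + Bw))) := by
    calc (Aᶜ.card : ℝ) * (‖b₀‖ * ‖Φ‖ + ‖a₀‖ * ‖Χ‖) ^ 2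
        ≤ ((Aᶜ.card : ℝ) * ‖b₀‖ ^ 2 + ‖Χ‖ ^ 2) * (‖Φ‖ ^ 2 + (Aᶜ.card : ℝ) * ‖a₀‖ ^ 2) := h2
      _ ≤ ((Aᶜ.card : ℝ) * (‖b₀‖ ^ 2 + Bw)) * (M * (‖a₀‖ ^ 2 + Aw)) :=
          mul_le_mul h3 h4 (by positivity) (by positivity)
      _ = (Aᶜ.card : ℝ) * (M * ((‖a₀‖ ^ 2 + Aw) * (‖b₀‖ ^ 2 + Bw))) := by ring
  have h6 : (‖b₀‖ * ‖Φ‖ + ‖a₀‖ * ‖Χ‖) ^ 2 ≤ M * ((‖a₀‖ ^ 2 + Aw) * (‖b₀‖ ^ 2 + Bw)) :=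
    le_of_mul_le_mul_left h5 (by linarith)
  exact h1.trans h6

/-- **The `W` overlap bound, per cut.**  For a cut `A | Ā` with `|A| = k ≥ 1` and
`|Ā| = N − k ≥ 1`: `N·|⟨W_N| a ⊗ b⟩|² ≤ max(k, N − k)·‖a‖²·‖b‖²` (the maximal squared Schmidt
coefficient of `|W_N⟩` across the cut, eq. (71); maximised over cuts it gives `(N−1)/N`, eq. (74)),
from `normSq_wN_overlap_le_lowMass` and `|a₀|² + Σ|a(e_i)|² ≤ ‖a‖²`, `|b₀|² + Σ|b(e_j)|² ≤ ‖b‖²`.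
[cite: GuhneToth2009, §3.6.1 eqs. (70)–(71) and §3.6.2 eq. (74); §6.8.2] -/
theorem normSq_wN_overlap_le (hA : A.Nonempty) (hAc : Aᶜ.Nonempty)
    (a : ({i // i ∈ A} → Bool) → ℂ) (b : ({i // i ∉ A} → Bool) → ℂ) :
    (N : ℝ) * Complex.normSq (star (wN N) ⬝ᵥ tensorAcross A a b) ≤
      (max A.card Aᶜ.card : ℕ) * ((∑ u, Complex.normSq (a u)) * (∑ v, Complex.normSq (b v))) := by
  refine (normSq_wN_overlap_le_lowMass hA hAc a b).trans ?_
  refine mul_le_mul_of_nonneg_left ?_ (Nat.cast_nonneg _)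
  exact mul_le_mul (normSq_zero_add_sum_exc_le a) (normSq_zero_add_sum_exc_le b)
    (add_nonneg (Complex.normSq_nonneg _) (Finset.sum_nonneg fun _ _ => Complex.normSq_nonneg _))
    (Finset.sum_nonneg fun _ _ => Complex.normSq_nonneg _)

/-- `max(|A|, |Ā|) ≤ N − 1` for a cut with both sides non-empty. [cite: GuhneToth2009, §3.6.2
eq. (74)] -/
private theorem max_card_le (hA : A.Nonempty) (hAc : Aᶜ.Nonempty) :
    ((max A.card Aᶜ.card : ℕ) : ℝ) ≤ N - 1 := by
  have hsum : A.card + Aᶜ.card = N := by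
    rw [Finset.card_add_card_compl, Fintype.card_fin]
  have hk := hA.card_pos
  have hm := hAc.card_pos
  have : max A.card Aᶜ.card ≤ N - 1 := by
    rcases le_total A.card Aᶜ.card with h | h
    · rw [max_eq_right h]; omega
    · rw [max_eq_left h]; omega
  have hN : 1 ≤ N := by omega
  calc ((max A.card Aᶜ.card : ℕ) : ℝ) ≤ ((N - 1 : ℕ) : ℝ) := by exact_mod_cast this
    _ = N - 1 := by rw [Nat.cast_sub hN, Nat.cast_one]

/-- **The maximal overlap of `|W_N⟩` with biseparable pure states is at most `(N−1)/N`**: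
`|⟨W_N|ψ⟩|² ≤ ((N−1)/N)·⟨ψ|ψ⟩` for every biseparable pure `ψ` — the constant of the witness (74).
[cite: GuhneToth2009, §3.6.2 eq. (74) with §3.6.1 eqs. (70)–(71)] -/
theorem normSq_wN_overlap_le_of_isBiseparablePure {ψ : (Fin N → Bool) → ℂ}
    (hψ : IsBiseparablePure ψ) :
    Complex.normSq (star (wN N) ⬝ᵥ ψ) ≤ (N - 1) / N * (star ψ ⬝ᵥ ψ).re := by
  obtain ⟨A, hA, hAc, a, b, rfl⟩ := hψ
  have hN : (0 : ℝ) < N := by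
    obtain ⟨i, -⟩ := hA
    exact_mod_cast Fin.pos i
  rw [star_dotProduct_self_re, tensorAcross_normSq]
  have h := normSq_wN_overlap_le hA hAc a b
  have hS : 0 ≤ (∑ u, Complex.normSq (a u)) * (∑ v, Complex.normSq (b v)) :=
    mul_nonneg (Finset.sum_nonneg fun _ _ => Complex.normSq_nonneg _)
      (Finset.sum_nonneg fun _ _ => Complex.normSq_nonneg _)
  have h' : (N : ℝ) * Complex.normSq (star (wN N) ⬝ᵥ tensorAcross A a b) ≤
      (N - 1) * ((∑ u, Complex.normSq (a u)) * (∑ v, Complex.normSq (b v))) :=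
    h.trans (mul_le_mul_of_nonneg_right (max_card_le hA hAc) hS)
  rw [div_mul_eq_mul_div, le_div_iff₀ hN, mul_comm]
  exact h'

/-! ## Tightness: `|0⟩ ⊗ |W_{N−1}⟩` has squared overlap exactly `(N−1)/N` -/

/-- The biseparable state `|0…0⟩_A ⊗ |W⟩_Ā` (vacuum on `A`, the `W` vector of the remaining
`|Ā|` qubits) has `|⟨W_N| 0_A ⊗ W_Ā⟩|² = |Ā|/N`; for `|A| = 1` this is `(N−1)/N`, so the
constant in (74) cannot be lowered (“the maximal overlap”). [cite: GuhneToth2009, §3.6.2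
eq. (74)] -/
theorem normSq_wN_overlap_zero_tensor [NeZero N] (A : Finset (Fin N)) :
    Complex.normSq (star (wN N) ⬝ᵥ
        tensorAcross A (fun x => if x = (fun _ => false) then 1 else 0) (wVec {i // i ∉ A})) =
      (Aᶜ.card : ℝ) / N := by
  have hau : ∀ u : {i // i ∈ A},
      (fun x : {i // i ∈ A} → Bool => if x = (fun _ => false) then (1 : ℂ) else 0) (exc u) = 0 :=
    fun u => if_neg (exc_ne_zero u)
  have hdot : star (wN N) ⬝ᵥ
      tensorAcross A (fun x => if x = (fun _ => false) then 1 else 0) (wVec {i // i ∉ A}) =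
        ((wAmp (Fin N) * (Aᶜ.card * wAmp {i // i ∉ A}) : ℝ) : ℂ) := by
    rw [star_wN_dotProduct_tensorAcross]
    simp only [hau, wVec_zero, wVec_exc, Finset.sum_const_zero, mul_zero, zero_add,
      Finset.sum_const, Finset.card_univ, nsmul_eq_mul, card_out]
    simp
  rw [hdot, Complex.normSq_ofReal]
  have hN : (N : ℝ) ≠ 0 := by exact_mod_cast NeZero.ne N
  have hn : wAmp (Fin N) * wAmp (Fin N) * N = 1 := wAmp_fin_sq_mul
  rcases Nat.eq_zero_or_pos Aᶜ.card with h0 | hpos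
  · simp [h0]
  · haveI : Nonempty {i // i ∉ A} := Fintype.card_pos_iff.1 (by rw [card_out]; exact hpos)
    have hm := wAmp_mul_wAmp_mul_card (ι := {i // i ∉ A})
    rw [card_out] at hm
    rw [eq_div_iff hN]
    linear_combination ((Aᶜ.card : ℝ) ^ 2 * wAmp {i // i ∉ A} ^ 2) * hn + (Aᶜ.card : ℝ) * hm

end Cut

/-! ## Mixed states: the witness `𝒲_{W_N} = ((N−1)/N)𝟙 − |W_N⟩⟨W_N|` (eq. (74)) -/

/-- The fidelity with `|W_N⟩`: `F(ρ, |W_N⟩) = ⟨W_N|ρ|W_N⟩` (the `F` of Table 2).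
[cite: GuhneToth2009, §6.8 Table 2 and §3.6.1 eq. (70)] -/
noncomputable def wFidelity (ρ : Matrix (Fin N → Bool) (Fin N → Bool) ℂ) : ℝ :=
  vecState (wN N) ρ

/-- Unfolding: `F(ρ, |W_N⟩) = Re⟨W_N|ρ|W_N⟩`. [cite: GuhneToth2009, §3.6.1 eq. (70)] -/
theorem wFidelity_eq (ρ : Matrix (Fin N → Bool) (Fin N → Bool) ℂ) :
    wFidelity ρ = (star (wN N) ⬝ᵥ (ρ *ᵥ wN N)).re := rfl

/-- **Cone form of (74).**  For `ρ = Σ p_i |ψ_i⟩⟨ψ_i|` with `p_i ≥ 0` and biseparable `ψ_i`: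
`⟨W_N|ρ|W_N⟩ ≤ ((N−1)/N)·Tr ρ`. [cite: GuhneToth2009, §3.6.2 eq. (74) with §3.6.1 eq. (70)] -/
theorem wFidelity_le_trace {ι : Type*} [Fintype ι] {p : ι → ℝ} (hp : ∀ i, 0 ≤ p i)
    {ψ : ι → (Fin N → Bool) → ℂ} (hψ : ∀ i, IsBiseparablePure (ψ i)) :
    wFidelity (∑ i, (p i : ℂ) • vecMulVec (ψ i) (star (ψ i))) ≤
      (N - 1) / N * (∑ i, (p i : ℂ) • vecMulVec (ψ i) (star (ψ i))).trace.re := by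
  rw [wFidelity, vecState_sum_smul_vecMulVec, trace_sum_smul_vecMulVec, Complex.re_sum,
    Finset.mul_sum]
  refine Finset.sum_le_sum fun i _ => ?_
  rw [Complex.re_ofReal_mul, ← mul_assoc, mul_comm ((N - 1) / N : ℝ) (p i), mul_assoc]
  exact mul_le_mul_of_nonneg_left (normSq_wN_overlap_le_of_isBiseparablePure (hψ i)) (hp i)

/-- **The witness inequality (74)**: `F(ρ, |W_N⟩) ≤ (N−1)/N` for every biseparable `ρ`.
[cite: GuhneToth2009, §3.6.2 eq. (74)] -/
theorem wFidelity_le {ρ : Matrix (Fin N → Bool) (Fin N → Bool) ℂ} (hρ : IsBiseparable ρ) :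
    wFidelity ρ ≤ (N - 1) / N := by
  have htr := trace_eq_one_of_isBiseparable hρ
  obtain ⟨ι, _, p, ψ, hp, -, -, hψ, rfl⟩ := hρ
  have h := wFidelity_le_trace hp hψ
  rwa [htr, Complex.one_re, mul_one] at h

/-- **The GME criterion of (74)**: `F(ρ, |W_N⟩) > (N−1)/N ⟹ ρ` is not biseparable (genuinely
`N`-partite entangled). [cite: GuhneToth2009, §3.6.2 eq. (74)] -/
theorem not_isBiseparable_of_lt_wFidelity {ρ : Matrix (Fin N → Bool) (Fin N → Bool) ℂ}
    (h : (N - 1) / N < wFidelity ρ) : ¬ IsBiseparable ρ :=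
  fun hρ => absurd h (not_lt.2 (wFidelity_le hρ))

/-- The criterion is not vacuous: `F(|W_N⟩⟨W_N|, |W_N⟩) = 1` (`N ≥ 1`). [cite: GuhneToth2009,
§3.6.1 eq. (70) (“`α < 1`”)] -/
theorem wFidelity_wN [NeZero N] : wFidelity (vecMulVec (wN N) (star (wN N))) = 1 := by
  rw [wFidelity, vecState_vecMulVec, wN_norm, map_one]

/-- `|W_N⟩` is genuinely `N`-partite entangled (`N ≥ 1`): `|W_N⟩⟨W_N|` is not biseparable.
[cite: GuhneToth2009, §3.3 (after eq. (42)) and §3.6.2 eq. (74)] -/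
theorem not_isBiseparable_wN [NeZero N] :
    ¬ IsBiseparable (vecMulVec (wN N) (star (wN N))) := by
  refine not_isBiseparable_of_lt_wFidelity ?_
  rw [wFidelity_wN]
  have hN : (0 : ℝ) < N := by exact_mod_cast Nat.pos_of_ne_zero (NeZero.ne N)
  rw [div_lt_one hN]
  linarith

/-- The witness operator of eq. (74): `𝒲_{W_N} = ((N−1)/N)·𝟙 − |W_N⟩⟨W_N|`.
[cite: GuhneToth2009, §3.6.2 eq. (74)] -/
noncomputable def wWitness (N : ℕ) : Matrix (Fin N → Bool) (Fin N → Bool) ℂ :=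
  (((N : ℝ) - 1) / N) • (1 : Matrix (Fin N → Bool) (Fin N → Bool) ℂ) -
    vecMulVec (wN N) (star (wN N))

/-- `Tr(ρ 𝒲_{W_N}) = ((N−1)/N)·Re Tr ρ − F(ρ, |W_N⟩)`. [cite: GuhneToth2009, §3.6.2 eq. (74)
with §3.6.1 eq. (70)] -/
theorem trState_wWitness (ρ : Matrix (Fin N → Bool) (Fin N → Bool) ℂ) :
    trState ρ (wWitness N) = (N - 1) / N * ρ.trace.re - wFidelity ρ := by
  rw [wWitness, map_sub, map_smul, smul_eq_mul, trState_apply, Matrix.mul_one, trState_apply,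
    Matrix.mul_vecMulVec, trace_vecMulVec, dotProduct_comm, wFidelity_eq]

/-- **Eq. (74) as printed**: `𝒲_{W_N}` is an entanglement witness for genuine `N`-partite
entanglement — `Tr(ρ 𝒲_{W_N}) ≥ 0` for every biseparable `ρ`. [cite: GuhneToth2009, §3.6.2
eq. (74)] -/
theorem guhneToth_wWitness {ρ : Matrix (Fin N → Bool) (Fin N → Bool) ℂ} (hρ : IsBiseparable ρ) :
    0 ≤ trState ρ (wWitness N) := by
  rw [trState_wWitness, trace_eq_one_of_isBiseparable hρ, Complex.one_re, mul_one]
  have h := wFidelity_le hρ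
  linarith

/-- `Tr(|W_N⟩⟨W_N| 𝒲_{W_N}) = −1/N < 0`: the witness detects its own state (`N ≥ 1`).
[cite: GuhneToth2009, §3.6.1 eq. (70) and §3.6.2 eq. (74)] -/
theorem trState_wWitness_wN [NeZero N] :
    trState (vecMulVec (wN N) (star (wN N))) (wWitness N) = -1 / N := by
  rw [trState_wWitness, trace_vecMulVec, dotProduct_comm, wN_norm, Complex.one_re, mul_one,
    wFidelity_wN]
  have hN : (N : ℝ) ≠ 0 := by exact_mod_cast NeZero.ne N
  field_simp
  ring

/-! ## The improved witness (162): `𝒲 = ((N−1)/N)·P_{≤2} − |W_N⟩⟨W_N|` -/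

section Excitations

variable {ι : Type*} [Fintype ι]

/-- The number of excitations (qubits in `|1⟩`) of a basis label. [cite: GuhneToth2009, §6.8.2
(“the subspace with one excitation (= `|1⟩`)”)] -/
def excCount (x : ι → Bool) : ℕ := (Finset.univ.filter fun i => x i = true).card

/-- `excCount` as a sum of indicators. [cite: GuhneToth2009, §6.8.2] -/
theorem excCount_eq_sum (x : ι → Bool) : excCount x = ∑ i, if x i = true then 1 else 0 := by
  rw [excCount, Finset.card_filter]

/-- The vacuum has no excitation. [cite: GuhneToth2009, §6.8.2] -/
@[simp] theorem excCount_zero : excCount (fun _ : ι => false) = 0 := by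
  simp [excCount]

variable [DecidableEq ι]

/-- `e_i` has exactly one excitation. [cite: GuhneToth2009, §6.8.2] -/
@[simp] theorem excCount_exc (i : ι) : excCount (exc i) = 1 := by
  rw [excCount]
  have : (Finset.univ.filter fun j => exc i j = true) = {i} := by
    ext j
    simp
  rw [this, Finset.card_singleton]

/-- The labels entering the one-excitation reduction on one side of a cut: the vacuum `0…0` and
the `e_i`. [cite: GuhneToth2009, §6.8.2] -/
def lowLabels (ι : Type*) [Fintype ι] [DecidableEq ι] : Finset (ι → Bool) :=
  insert (fun _ => false) (Finset.univ.image (exc : ι → ι → Bool))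

/-- Low labels have at most one excitation. [cite: GuhneToth2009, §6.8.2] -/
theorem excCount_le_one_of_mem_lowLabels {x : ι → Bool} (hx : x ∈ lowLabels ι) :
    excCount x ≤ 1 := by
  rw [lowLabels, Finset.mem_insert, Finset.mem_image] at hx
  rcases hx with rfl | ⟨i, -, rfl⟩
  · simp
  · simp

/-- `Σ_{x ∈ lowLabels} f(x) = f(0…0) + Σ_i f(e_i)` (the labels are distinct).
[cite: GuhneToth2009, §6.8.2] -/
theorem sum_lowLabels (f : (ι → Bool) → ℝ) :
    ∑ x ∈ lowLabels ι, f x = f (fun _ => false) + ∑ i, f (exc i) := by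
  have h0 : (fun _ => false : ι → Bool) ∉ Finset.univ.image (exc : ι → ι → Bool) := by
    simp [Finset.mem_image, exc_ne_zero]
  rw [lowLabels, Finset.sum_insert h0, Finset.sum_image fun i _ j _ h => exc_injective h]

end Excitations

/-- A sum over the `N` qubits splits into the qubits of `A` and those of `Ā`.
[cite: GuhneToth2009, §6.8.2] -/
private theorem sum_split (A : Finset (Fin N)) {M : Type*} [AddCommMonoid M] (f : Fin N → M) :
    ∑ i, f i = ∑ u : {i // i ∈ A}, f u + ∑ v : {i // i ∉ A}, f v := by
  rw [← Fintype.sum_equiv (Equiv.sumCompl (· ∈ A))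
      (fun s => f (Equiv.sumCompl (· ∈ A) s)) f (fun _ => rfl), Fintype.sum_sum_type]
  simp only [Equiv.sumCompl_apply_inl, Equiv.sumCompl_apply_inr]

/-- Excitations add up across a cut: `#x = #(x|_A) + #(x|_Ā)`. [cite: GuhneToth2009, §6.8.2] -/
theorem excCount_eq_add (A : Finset (Fin N)) (x : Fin N → Bool) :
    excCount x = excCount (restrictIn A x) + excCount (restrictOut A x) := by
  simp only [excCount_eq_sum]
  exact sum_split A (fun i => if x i = true then 1 else 0)

/-- `P_{≤2}`: the projector onto the span of the basis labels with at most two excitations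
(“where `P_{≤2}` is the projector onto the space with maximally two excitations”).
[cite: GuhneToth2009, §6.8.2 eq. (162)] -/
noncomputable def projLE2 (N : ℕ) : Matrix (Fin N → Bool) (Fin N → Bool) ℂ :=
  Matrix.diagonal fun x => if excCount x ≤ 2 then 1 else 0

/-- `⟨ψ|P_{≤2}|ψ⟩ = Σ_{#x ≤ 2} |ψ(x)|²`. [cite: GuhneToth2009, §6.8.2 eq. (162)] -/
theorem vecState_projLE2 (ψ : (Fin N → Bool) → ℂ) :
    vecState ψ (projLE2 N) =
      ∑ x ∈ Finset.univ.filter (fun x => excCount x ≤ 2), Complex.normSq (ψ x) := by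
  rw [vecState_apply, projLE2, Finset.sum_filter]
  simp only [dotProduct, mulVec_diagonal, Pi.star_apply]
  rw [Complex.re_sum]
  refine Finset.sum_congr rfl fun x _ => ?_
  split_ifs with h
  · rw [one_mul, Complex.star_def, ← Complex.normSq_eq_conj_mul_self, Complex.ofReal_re]
  · simp

/-- `⟨ψ|P_{≤2}|ψ⟩ ≥ 0`. [cite: GuhneToth2009, §6.8.2 eq. (162)] -/
theorem vecState_projLE2_nonneg (ψ : (Fin N → Bool) → ℂ) : 0 ≤ vecState ψ (projLE2 N) := by
  rw [vecState_projLE2]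
  exact Finset.sum_nonneg fun _ _ => Complex.normSq_nonneg _

/-- **The observation behind (162).**  The vacuum/one-excitation mass of the two sides of a
product `a ⊗ b` is carried by labels of the whole register with at most two excitations:
`(|a(0)|² + Σ_i|a(e_i)|²)·(|b(0)|² + Σ_j|b(e_j)|²) ≤ ⟨a ⊗ b|P_{≤2}|a ⊗ b⟩` (“any contribution
with two ore more `|1⟩` in `|a⟩` or `|b⟩` has a vanishing overlap with the state `|W_N⟩`”).
[cite: GuhneToth2009, §6.8.2 eq. (162)] -/
theorem lowMass_le_vecState_projLE2 (A : Finset (Fin N)) (a : ({i // i ∈ A} → Bool) → ℂ)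
    (b : ({i // i ∉ A} → Bool) → ℂ) :
    (Complex.normSq (a fun _ => false) + ∑ u, Complex.normSq (a (exc u))) *
        (Complex.normSq (b fun _ => false) + ∑ v, Complex.normSq (b (exc v))) ≤
      vecState (tensorAcross A a b) (projLE2 N) := by
  classical
  let e := Equiv.piEquivPiSubtypeProd (fun i : Fin N => i ∈ A) (fun _ => Bool)
  have h1 : ∀ q : ({i // i ∈ A} → Bool) × ({i // i ∉ A} → Bool),
      restrictIn A (e.symm q) = q.1 := fun q => congrArg Prod.fst (e.apply_symm_apply q)
  have h2 : ∀ q : ({i // i ∈ A} → Bool) × ({i // i ∉ A} → Bool),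
      restrictOut A (e.symm q) = q.2 := fun q => congrArg Prod.snd (e.apply_symm_apply q)
  rw [← sum_lowLabels (fun u => Complex.normSq (a u)), ← sum_lowLabels (fun v => Complex.normSq (b v)),
    Finset.sum_mul_sum, ← Finset.sum_product', vecState_projLE2]
  have step : ∑ q ∈ lowLabels {i // i ∈ A} ×ˢ lowLabels {i // i ∉ A},
      Complex.normSq (a q.1) * Complex.normSq (b q.2) =
      ∑ x ∈ (lowLabels {i // i ∈ A} ×ˢ lowLabels {i // i ∉ A}).image e.symm,
        Complex.normSq (tensorAcross A a b x) := by
    rw [Finset.sum_image fun x _ y _ hxy => e.symm.injective hxy]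
    refine Finset.sum_congr rfl fun q _ => ?_
    rw [tensorAcross_apply, Complex.normSq_mul, h1, h2]
  rw [step]
  refine Finset.sum_le_sum_of_subset_of_nonneg ?_ fun _ _ _ => Complex.normSq_nonneg _
  intro x hx
  rw [Finset.mem_image] at hx
  obtain ⟨q, hq, rfl⟩ := hx
  rw [Finset.mem_product] at hq
  rw [Finset.mem_filter, excCount_eq_add A, h1, h2]
  have hq1 := excCount_le_one_of_mem_lowLabels hq.1
  have hq2 := excCount_le_one_of_mem_lowLabels hq.2
  exact ⟨Finset.mem_univ _, by omega⟩

/-- **(162), per cut**: `N·|⟨W_N| a ⊗ b⟩|² ≤ max(|A|, |Ā|)·⟨a ⊗ b|P_{≤2}|a ⊗ b⟩`.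
[cite: GuhneToth2009, §6.8.2 eq. (162)] -/
theorem normSq_wN_overlap_le_projLE2 {A : Finset (Fin N)} (hA : A.Nonempty) (hAc : Aᶜ.Nonempty)
    (a : ({i // i ∈ A} → Bool) → ℂ) (b : ({i // i ∉ A} → Bool) → ℂ) :
    (N : ℝ) * Complex.normSq (star (wN N) ⬝ᵥ tensorAcross A a b) ≤
      (max A.card Aᶜ.card : ℕ) * vecState (tensorAcross A a b) (projLE2 N) :=
  (normSq_wN_overlap_le_lowMass hA hAc a b).trans
    (mul_le_mul_of_nonneg_left (lowMass_le_vecState_projLE2 A a b) (Nat.cast_nonneg _))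

/-- **(162) for biseparable pure states**: `|⟨W_N|ψ⟩|² ≤ ((N−1)/N)·⟨ψ|P_{≤2}|ψ⟩`.
[cite: GuhneToth2009, §6.8.2 eq. (162)] -/
theorem normSq_wN_overlap_le_projLE2_of_isBiseparablePure {ψ : (Fin N → Bool) → ℂ}
    (hψ : IsBiseparablePure ψ) :
    Complex.normSq (star (wN N) ⬝ᵥ ψ) ≤ (N - 1) / N * vecState ψ (projLE2 N) := by
  obtain ⟨A, hA, hAc, a, b, rfl⟩ := hψ
  have hN : (0 : ℝ) < N := by
    obtain ⟨i, -⟩ := hA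
    exact_mod_cast Fin.pos i
  have h := normSq_wN_overlap_le_projLE2 hA hAc a b
  have h' := h.trans (mul_le_mul_of_nonneg_right (max_card_le hA hAc)
    (vecState_projLE2_nonneg (tensorAcross A a b)))
  rw [div_mul_eq_mul_div, le_div_iff₀ hN]
  linarith

/-- The improved witness of eq. (162): `𝒲 = ((N−1)/N)·P_{≤2} − |W_N⟩⟨W_N|`.
[cite: GuhneToth2009, §6.8.2 eq. (162)] -/
noncomputable def wWitness₂ (N : ℕ) : Matrix (Fin N → Bool) (Fin N → Bool) ℂ :=
  (((N : ℝ) - 1) / N) • projLE2 N - vecMulVec (wN N) (star (wN N))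

/-- `⟨ψ|𝒲|ψ⟩ = ((N−1)/N)⟨ψ|P_{≤2}|ψ⟩ − |⟨W_N|ψ⟩|²`. [cite: GuhneToth2009, §6.8.2 eq. (162)] -/
theorem vecState_wWitness₂ (ψ : (Fin N → Bool) → ℂ) :
    vecState ψ (wWitness₂ N) =
      (N - 1) / N * vecState ψ (projLE2 N) - Complex.normSq (star (wN N) ⬝ᵥ ψ) := by
  rw [wWitness₂, map_sub, map_smul, smul_eq_mul, vecState_vecMulVec, star_dotProduct ψ (wN N),
    Complex.star_def, Complex.normSq_conj]

/-- **(162) is “a valid witness”, pure case**: `⟨ψ|𝒲|ψ⟩ ≥ 0` for biseparable pure `ψ`.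
[cite: GuhneToth2009, §6.8.2 eq. (162)] -/
theorem guhneToth_wWitness₂_pure {ψ : (Fin N → Bool) → ℂ} (hψ : IsBiseparablePure ψ) :
    0 ≤ vecState ψ (wWitness₂ N) := by
  rw [vecState_wWitness₂]
  have h := normSq_wN_overlap_le_projLE2_of_isBiseparablePure hψ
  linarith

/-- `Tr(|ψ⟩⟨ψ| M) = ⟨ψ|M|ψ⟩` (real parts). [cite: GuhneToth2009, §3.6.1 eq. (70)] -/
private theorem trState_vecMulVec {κ : Type*} [Fintype κ] [DecidableEq κ] (ψ : κ → ℂ)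
    (M : Matrix κ κ ℂ) : trState (vecMulVec ψ (star ψ)) M = vecState ψ M := by
  rw [trState_apply, vecState_apply, Matrix.trace_mul_comm, Matrix.mul_vecMulVec,
    Matrix.trace_vecMulVec, dotProduct_comm]

/-- `Tr((Σ p_i |ψ_i⟩⟨ψ_i|) M) = Σ p_i ⟨ψ_i|M|ψ_i⟩`. [cite: GuhneToth2009, §3.6.1 eq. (70)] -/
private theorem trState_mixture {ι : Type*} [Fintype ι] {κ : Type*} [Fintype κ] [DecidableEq κ]
    (p : ι → ℝ) (ψ : ι → κ → ℂ) (M : Matrix κ κ ℂ) :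
    trState (∑ i, (p i : ℂ) • vecMulVec (ψ i) (star (ψ i))) M = ∑ i, p i * vecState (ψ i) M := by
  rw [trState_apply, Finset.sum_mul, Matrix.trace_sum, Complex.re_sum]
  refine Finset.sum_congr rfl fun i _ => ?_
  rw [Matrix.smul_mul, Matrix.trace_smul, smul_eq_mul, Complex.re_ofReal_mul, ← trState_apply,
    trState_vecMulVec]

/-- **Eq. (162) as printed**: `𝒲 = ((N−1)/N)·P_{≤2} − |W_N⟩⟨W_N|` “is a valid witness” —
`Tr(ρ𝒲) ≥ 0` for every biseparable `ρ`. [cite: GuhneToth2009, §6.8.2 eq. (162)] -/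
theorem guhneToth_wWitness₂ {ρ : Matrix (Fin N → Bool) (Fin N → Bool) ℂ} (hρ : IsBiseparable ρ) :
    0 ≤ trState ρ (wWitness₂ N) := by
  obtain ⟨ι, _, p, ψ, hp, -, -, hψ, rfl⟩ := hρ
  rw [trState_mixture]
  exact Finset.sum_nonneg fun i _ => mul_nonneg (hp i) (guhneToth_wWitness₂_pure (hψ i))

/-- `⟨W_N|P_{≤2}|W_N⟩ = 1`: `|W_N⟩` lives in the one-excitation subspace (`N ≥ 1`).
[cite: GuhneToth2009, §6.8.2] -/
theorem vecState_projLE2_wN [NeZero N] : vecState (wN N) (projLE2 N) = 1 := by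
  rw [vecState_projLE2]
  have h : ∑ x ∈ Finset.univ.filter (fun x => excCount x ≤ 2), Complex.normSq (wN N x) =
      ∑ x, Complex.normSq (wN N x) := by
    apply Finset.sum_subset (Finset.filter_subset _ _)
    intro x _ hx
    rw [Finset.mem_filter, not_and] at hx
    have hx' : ¬ excCount x ≤ 2 := hx (Finset.mem_univ _)
    rw [wN_eq, wVec_apply, Complex.normSq_mul]
    have h0 : ∑ i : Fin N, (if x = exc i then (1 : ℂ) else 0) = 0 := by
      refine Finset.sum_eq_zero fun i _ => ?_
      rw [if_neg]
      rintro rfl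
      exact hx' (by simp)
    rw [h0, map_zero, mul_zero]
  rw [h, ← star_dotProduct_self_re, wN_norm, Complex.one_re]

/-- `Tr(|W_N⟩⟨W_N| 𝒲) = −1/N < 0` for the improved witness too: it detects `|W_N⟩` (`N ≥ 1`).
[cite: GuhneToth2009, §6.8.2 eq. (162)] -/
theorem trState_wWitness₂_wN [NeZero N] :
    trState (vecMulVec (wN N) (star (wN N))) (wWitness₂ N) = -1 / N := by
  rw [trState_vecMulVec, vecState_wWitness₂, vecState_projLE2_wN, wN_norm, map_one]
  have hN : (N : ℝ) ≠ 0 := by exact_mod_cast NeZero.ne N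
  field_simp
  ring

/-- `P_{≤2} ≤ 𝟙` in every vector state: `⟨ψ|P_{≤2}|ψ⟩ ≤ ⟨ψ|ψ⟩`, so (162) is at least as strong
as (74) (“a significant improvement, as the difference between `P_{≤2}` and `𝟙` increases
exponentially”). [cite: GuhneToth2009, §6.8.2 (after eq. (162))] -/
theorem vecState_projLE2_le (ψ : (Fin N → Bool) → ℂ) :
    vecState ψ (projLE2 N) ≤ (star ψ ⬝ᵥ ψ).re := by
  rw [vecState_projLE2, star_dotProduct_self_re]
  exact Finset.sum_le_sum_of_subset_of_nonneg (Finset.filter_subset _ _)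
    fun _ _ _ => Complex.normSq_nonneg _

/-! ## Reading Table 2 against the criterion `F > (N−1)/N` -/

/-- Table 2, `N = 4`: `F = 0.846 > 3/4`, so the fidelity witness (74) detects the four-ion
state. [cite: GuhneToth2009, §6.8 Table 2 and §6.8.2] -/
theorem table2_detects_four : ((4 : ℝ) - 1) / 4 < 0.846 := by norm_num

/-- Table 2, `N = 5,…,8`: `F = 0.759, 0.788, 0.763, 0.722` are all `≤ (N−1)/N` — “this witness
does not detect any entanglement for `N ≥ 5`”. [cite: GuhneToth2009, §6.8 Table 2 and §6.8.2] -/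
theorem table2_not_detected_five_to_eight :
    (0.759 : ℝ) ≤ ((5 : ℝ) - 1) / 5 ∧ (0.788 : ℝ) ≤ ((6 : ℝ) - 1) / 6 ∧
      (0.763 : ℝ) ≤ ((7 : ℝ) - 1) / 7 ∧ (0.722 : ℝ) ≤ ((8 : ℝ) - 1) / 8 := by
  norm_num

/-! ## White-noise tolerance of the `W` fidelity witness (appended, harvest-2 gen 43)

Gühne–Tóth, Phys. Rep. 474 (2009), Table 1: for the witness `((N−1)/N)𝟙 − |W_N⟩⟨W_N|` the
“maximal `p_noise`” is `1/N·[1/(1 − 1/2^N)]`; row `|W₃⟩`: witness `⅔𝟙 − |W₃⟩⟨W₃|`, maximal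
`p_noise = 8/21`. -/

/-- The `W` state mixed with white noise, `ϱ(p) = (1 − p)|W_N⟩⟨W_N| + p·𝟙/2^N`.
[cite: GuhneToth2009, §6.1.3 (i) (robustness to white noise) and Table 1 row `|W_N⟩`] -/
noncomputable def wWhiteNoise (N : ℕ) (p : ℝ) : Matrix (Fin N → Bool) (Fin N → Bool) ℂ :=
  (1 - p) • vecMulVec (wN N) (star (wN N)) +
    (p / 2 ^ N) • (1 : Matrix (Fin N → Bool) (Fin N → Bool) ℂ)

/-- `F(ϱ(p), |W_N⟩) = (1 − p) + p/2^N` (`N ≥ 1`). [cite: GuhneToth2009, Table 1 row `|W_N⟩`] -/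
theorem wFidelity_wWhiteNoise [NeZero N] (p : ℝ) :
    wFidelity (wWhiteNoise N p) = (1 - p) + p / 2 ^ N := by
  have h1 : vecState (wN N) (1 : Matrix (Fin N → Bool) (Fin N → Bool) ℂ) = 1 := by
    rw [vecState_apply, one_mulVec, wN_norm, Complex.one_re]
  rw [wFidelity, wWhiteNoise, map_add, map_smul, map_smul, smul_eq_mul, smul_eq_mul, h1, mul_one,
    ← wFidelity, wFidelity_wN, mul_one]

/-- **Table 1, row `|W_N⟩`**: the fidelity witness detects `ϱ(p)` (`F > (N−1)/N`) exactly for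
`p < 1/N·[1/(1 − 1/2^N)]` (`N ≥ 1`). [cite: GuhneToth2009, Table 1 (witness
`((N−1)/N)𝟙 − |W_N⟩⟨W_N|`, maximal `p_noise = 1/N·[1/(1 − 1/2^N)]`)] -/
theorem lt_wFidelity_wWhiteNoise_iff [NeZero N] (p : ℝ) :
    (N - 1) / N < wFidelity (wWhiteNoise N p) ↔ p < 1 / N * (1 / (1 - 1 / 2 ^ N)) := by
  rw [wFidelity_wWhiteNoise]
  have hN : (0 : ℝ) < N := by exact_mod_cast Nat.pos_of_ne_zero (NeZero.ne N)
  have h2 : (1 : ℝ) < 2 ^ N := by exact_mod_cast Nat.one_lt_two_pow (NeZero.ne N)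
  have h2N : (0 : ℝ) < 2 ^ N := by positivity
  have hpos : (0 : ℝ) < 1 - 1 / 2 ^ N := by
    rw [sub_pos, div_lt_one h2N]; exact h2
  rw [one_div (1 - 1 / 2 ^ N), ← div_eq_mul_inv, lt_div_iff₀ hpos,
    show ((N : ℝ) - 1) / N = 1 - 1 / N by field_simp]
  have e : p * (1 - 1 / 2 ^ N) = p - p / 2 ^ N := by ring
  constructor
  · intro h; linarith [e, h]
  · intro h; linarith [e, h]

/-- Hence `ϱ(p)` is genuinely `N`-partite entangled for `p < 1/N·[1/(1 − 1/2^N)]`.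
[cite: GuhneToth2009, Table 1 row `|W_N⟩`] -/
theorem not_isBiseparable_wWhiteNoise [NeZero N] {p : ℝ}
    (hp : p < 1 / N * (1 / (1 - 1 / 2 ^ N))) : ¬ IsBiseparable (wWhiteNoise N p) :=
  not_isBiseparable_of_lt_wFidelity ((lt_wFidelity_wWhiteNoise_iff p).2 hp)

/-- **`N = 3`: maximal `p_noise = 8/21`** (`⅓·[1/(1 − 1/8)]`). [cite: GuhneToth2009, Table 1 row
`|W₃⟩`] -/
theorem wWhiteNoise_threshold_three : (1 / 3 * (1 / (1 - 1 / 2 ^ 3)) : ℝ) = 8 / 21 := by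
  norm_num

end WWitness

end Literature.InformationTheory.Entanglement
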